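import Summits.AtomisticToContinuum.Crystallization.Theorems.OverbindingBudgetEnergyAffineStraightening
import Summits.AtomisticToContinuum.Crystallization.Theorems.OverbindingBudgetEnergySiteDecomposition

/-!
# OverbindingBudget · decomp-a2c lens-4 g34 — part XXII-P: the SITE-LEVEL affine lower bound (local half of STR-A, PROVED)

Helper file under `--supports stmt-AtomisticToContinuum-31280` (RDEF = `Theses.OverbindingBudget.RobustDefectLimitWindows`); closes nothing.

STR-A `AffineStraightenedFloor Λ₁` (part O) = a LOCAL half (every site's energy is bounded below by the affine minorants evaluated at ITS OWN span
heights, minus the tail allowance) + a GLOBAL half (regroup a cube's sites layer by layer, average the span heights — exact on the affine side — and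
control the drift of the span-wise weighted means; g35).  This part PROVES the local half, sorry-free:

* `inner_sub_up` / `inner_sub_down` — the span heights telescope into gap heights: `⟪w (m₀+k+1) − w m₀, n⟫ = Σ_{i ≤ k} ⟪incr w (m₀+i+1), n⟫` (and
  downwards); `span_height_bounds_up/down` — with all gap heights in `[η₁, η₂]` a span over `k+1` gaps has height in `[(k+1)η₁, (k+1)η₂]`;
* ★ `siteEnergy_affine_lower` — for a `δ ≥ 9/10`-separated layered configuration over a cell `‖a‖, ‖b‖ ≤ 17/16` with unit normal `n`, all gap heights
  in `[η₁, η₂]`, `η₁ ≥ 3/8`, `s₀ ≥ 4`, and affine minorants `α s + β s·P ≤ layerField a b (P•n + u)` on `[(s+1)η₁, (s+1)η₂]` (`s < s₀`, `u ⊥ n`):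
  `φ₀ + Σ_{k<s₀} (α k + β k·H⁺_k) + Σ_{k<s₀} (α k + β k·H⁻_k) − 2·22/(21 s₀³ η₁⁴) ≤ siteEnergy (Layered a b w) y` for every site `y` of layer `m₀`,
  `H^±_k` the heights of the spans from layer `m₀` to layers `m₀ ± (k+1)` — by DEC (part N), the split of the layer sum at `m₀` and at `±s₀`
  (`tsum_of_nat_of_neg_add_one`, `sum_add_tsum_nat_add`), the minorants on the `2 s₀` near layers and `layerField_far ≥ −(22/7)/P⁴` (part L) with
  `Σ_{k ≥ 0} ((k+s₀+1)η₁)⁻⁴ ≤ (3 s₀³ η₁⁴)⁻¹` on the far ones.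
Halving gives the per-site form of the mean floor: `φ₀/2 + Σ_{k<s₀} (α k + β k·(H⁺_k + H⁻_k)/2) − 22/(21 s₀³ η₁⁴) ≤ siteEnergy/2` (`siteEnergy_half_affine_lower`).
-/

noncomputable section

namespace Summit.AtomisticToContinuum.Crystallization.Theorems.OverbindingBudgetEnergySiteAffineBound

open Real Finset
open scoped RealInnerProductSpace
open Literature.MathematicalPhysics.StatisticalMechanics (lennardJones UniformlyDiscrete)
open Summit.AtomisticToContinuum.Crystallization.Theorems.ChartedPlanarOrderChunkFloor (E3)
open Summit.AtomisticToContinuum.Crystallization.Theorems.ChartedPlanarOrderDensityDichotomy (IsSep)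
open Summit.AtomisticToContinuum.Crystallization.Theorems.ChartedPlanarOrderDoorLayered (Layered)
open Summit.AtomisticToContinuum.Crystallization.Theorems.ChartedPlanarOrderProfileSlavingLJ (incr)
open Summit.AtomisticToContinuum.Crystallization.Theorems.OverbindingBudgetRegistryCut (IsUnitNormal)
open Summit.AtomisticToContinuum.Crystallization.Theorems.OverbindingBudgetEnergyPinningCut (siteEnergy)
open Summit.AtomisticToContinuum.Crystallization.Theorems.OverbindingBudgetEnergyStraightening (layerField le_norm_latticeVec_of_isSep)
open Summit.AtomisticToContinuum.Crystallization.Theorems.OverbindingBudgetEnergyLayerTailSum (gram_ge_of_cell layerField_far tsum_inv_pow_four_le)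
open Summit.AtomisticToContinuum.Crystallization.Theorems.OverbindingBudgetEnergySiteDecomposition (layerField_sub_comm siteEnergy_layered
  strictMono_heights)

/-! ## §1 Span heights telescope into gap heights -/

/-- upward spans: `⟪w (m₀ + (k+1)) − w m₀, n⟫ = Σ_{i<k+1} ⟪incr w (m₀ + (i+1)), n⟫`. [this file] -/
theorem inner_sub_up (w : ℤ → E3) (n : E3) (m₀ : ℤ) (k : ℕ) :
    ⟪w (m₀ + ((k : ℤ) + 1)) - w m₀, n⟫ = ∑ i ∈ range (k + 1), ⟪incr w (m₀ + ((i : ℤ) + 1)), n⟫ := by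
  have key : ∀ i : ℕ, ⟪incr w (m₀ + ((i : ℤ) + 1)), n⟫ = ⟪w (m₀ + (((i + 1 : ℕ) : ℤ))), n⟫ - ⟪w (m₀ + ((i : ℕ) : ℤ)), n⟫ := by
    intro i
    have e1 : m₀ + ((i : ℤ) + 1) = m₀ + (((i + 1 : ℕ)) : ℤ) := by push_cast; ring
    have e2 : m₀ + ((i : ℤ) + 1) - 1 = m₀ + (i : ℤ) := by ring
    unfold incr
    rw [e2, e1, inner_sub_left]
  simp_rw [key]
  rw [sum_range_sub (fun i : ℕ => ⟪w (m₀ + ((i : ℕ) : ℤ)), n⟫) (k + 1), ← inner_sub_left]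
  push_cast
  simp

/-- downward spans: `⟪w m₀ − w (m₀ − (k+1)), n⟫ = Σ_{i<k+1} ⟪incr w (m₀ − i), n⟫`. [this file] -/
theorem inner_sub_down (w : ℤ → E3) (n : E3) (m₀ : ℤ) (k : ℕ) :
    ⟪w m₀ - w (m₀ - ((k : ℤ) + 1)), n⟫ = ∑ i ∈ range (k + 1), ⟪incr w (m₀ - (i : ℤ)), n⟫ := by
  have key : ∀ i : ℕ, ⟪incr w (m₀ - (i : ℤ)), n⟫ = -(⟪w (m₀ - (((i + 1 : ℕ) : ℤ))), n⟫ - ⟪w (m₀ - ((i : ℕ) : ℤ)), n⟫) := by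
    intro i
    have e3 : m₀ - (i : ℤ) - 1 = m₀ - (((i + 1 : ℕ)) : ℤ) := by push_cast; ring
    unfold incr
    rw [e3, inner_sub_left]
    ring
  simp_rw [key]
  rw [sum_neg_distrib, sum_range_sub (fun i : ℕ => ⟪w (m₀ - ((i : ℕ) : ℤ)), n⟫) (k + 1), neg_sub, ← inner_sub_left]
  push_cast
  simp

/-- upward span heights lie in `[(k+1)η₁, (k+1)η₂]`. [this file] -/
theorem span_height_bounds_up {w : ℤ → E3} {n : E3} {η₁ η₂ : ℝ} (hband : ∀ m : ℤ, η₁ ≤ ⟪incr w m, n⟫ ∧ ⟪incr w m, n⟫ ≤ η₂)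
    (m₀ : ℤ) (k : ℕ) :
    ((k : ℝ) + 1) * η₁ ≤ ⟪w (m₀ + ((k : ℤ) + 1)) - w m₀, n⟫ ∧ ⟪w (m₀ + ((k : ℤ) + 1)) - w m₀, n⟫ ≤ ((k : ℝ) + 1) * η₂ := by
  rw [inner_sub_up]
  have h1 := card_nsmul_le_sum (range (k + 1)) (fun i : ℕ => ⟪incr w (m₀ + ((i : ℤ) + 1)), n⟫) η₁ fun i _ => (hband _).1
  have h2 := sum_le_card_nsmul (range (k + 1)) (fun i : ℕ => ⟪incr w (m₀ + ((i : ℤ) + 1)), n⟫) η₂ fun i _ => (hband _).2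
  rw [card_range, nsmul_eq_mul] at h1 h2
  push_cast at h1 h2
  exact ⟨h1, h2⟩

/-- downward span heights lie in `[(k+1)η₁, (k+1)η₂]`. [this file] -/
theorem span_height_bounds_down {w : ℤ → E3} {n : E3} {η₁ η₂ : ℝ} (hband : ∀ m : ℤ, η₁ ≤ ⟪incr w m, n⟫ ∧ ⟪incr w m, n⟫ ≤ η₂)
    (m₀ : ℤ) (k : ℕ) :
    ((k : ℝ) + 1) * η₁ ≤ ⟪w m₀ - w (m₀ - ((k : ℤ) + 1)), n⟫ ∧ ⟪w m₀ - w (m₀ - ((k : ℤ) + 1)), n⟫ ≤ ((k : ℝ) + 1) * η₂ := by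
  rw [inner_sub_down]
  have h1 := card_nsmul_le_sum (range (k + 1)) (fun i : ℕ => ⟪incr w (m₀ - (i : ℤ)), n⟫) η₁ fun i _ => (hband _).1
  have h2 := sum_le_card_nsmul (range (k + 1)) (fun i : ℕ => ⟪incr w (m₀ - (i : ℤ)), n⟫) η₂ fun i _ => (hband _).2
  rw [card_range, nsmul_eq_mul] at h1 h2
  push_cast at h1 h2
  exact ⟨h1, h2⟩

/-! ## §2 One inter-layer term: the affine minorant near, `−(22/7)/P⁴` far -/

/-- a near term: the layer field at an offset of height `P ∈ [(s+1)η₁, (s+1)η₂]` is at least the minorant `α s + β s·P`. [this file] -/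
theorem layerField_ge_affine {a b n v : E3} {η₁ η₂ : ℝ} {s₀ s : ℕ} {α β : ℕ → ℝ} (hn : IsUnitNormal a b n)
    (hmin : ∀ s : ℕ, s < s₀ → ∀ P : ℝ, ((s : ℝ) + 1) * η₁ ≤ P → P ≤ ((s : ℝ) + 1) * η₂ → ∀ u : E3, ⟪u, n⟫ = 0 →
      α s + β s * P ≤ layerField a b (P • n + u))
    (hs : s < s₀) (h1 : ((s : ℝ) + 1) * η₁ ≤ ⟪v, n⟫) (h2 : ⟪v, n⟫ ≤ ((s : ℝ) + 1) * η₂) :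
    α s + β s * ⟪v, n⟫ ≤ layerField a b v := by
  have hnn : ⟪n, n⟫ = 1 := by rw [real_inner_self_eq_norm_sq, hn.1, one_pow]
  have hu : ⟪v - ⟪v, n⟫ • n, n⟫ = 0 := by rw [inner_sub_left, inner_smul_left, hnn]; simp
  have := hmin s hs ⟪v, n⟫ h1 h2 _ hu
  rwa [add_sub_cancel] at this

/-- a far term: the layer field at an offset of height `P ≥ (k + s₀ + 1)·η₁ ≥ 15/8` is at least `−(22/7)·η₁⁻⁴·(k + s₀ + 1)⁻⁴`. [this file] -/
theorem layerField_ge_far {a b n v : E3} {η₁ : ℝ} {s₀ k : ℕ} (hab : LinearIndependent ℝ ![a, b]) (hn : IsUnitNormal a b n) (ha : ‖a‖ ≤ 17 / 16)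
    (hb : ‖b‖ ≤ 17 / 16) (hG : 9 / 20 ≤ ‖a‖ ^ 2 * ‖b‖ ^ 2 - ⟪a, b⟫ ^ 2) (h38 : 3 / 8 ≤ η₁) (hs₀ : 4 ≤ s₀)
    (h1 : (((k + s₀ : ℕ) : ℝ) + 1) * η₁ ≤ ⟪v, n⟫) :
    -(22 / 7 * (η₁ ^ 4)⁻¹ * ((((k : ℝ) + s₀ + 1) ^ 4)⁻¹)) ≤ layerField a b v := by
  have hs₀' : (4 : ℝ) ≤ s₀ := by exact_mod_cast hs₀
  have hη : 0 < η₁ := by linarith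
  have hk0 : 0 ≤ (k : ℝ) := Nat.cast_nonneg k
  have h1' : ((k : ℝ) + s₀ + 1) * η₁ ≤ ⟪v, n⟫ := by push_cast at h1; linarith
  have hP0 : 15 / 8 ≤ ⟪v, n⟫ := by nlinarith
  have hfar := (layerField_far hab hn ha hb hG rfl hP0).2.1
  have hQ : 0 < ((k : ℝ) + s₀ + 1) * η₁ := by positivity
  have hmono : (⟪v, n⟫ ^ 4)⁻¹ ≤ ((((k : ℝ) + s₀ + 1) * η₁) ^ 4)⁻¹ :=
    inv_anti₀ (by positivity) (pow_le_pow_left₀ hQ.le h1' 4)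
  rw [mul_pow, mul_inv] at hmono
  nlinarith [hmono, show (0 : ℝ) ≤ 22 / 7 from by norm_num]

/-! ## §3 ★ The site-level affine lower bound -/

/-- ★ **the local half of STR-A.** For a `δ ≥ 9/10`-separated layered configuration over a cell `‖a‖, ‖b‖ ≤ 17/16` (`a, b` independent) with unit
normal `n`, all gap heights in `[η₁, η₂]`, `η₁ ≥ 3/8`, `s₀ ≥ 4`, and affine minorants of the first `s₀` inter-layer fields on the band: the energy of every
site of layer `m₀` is at least `φ₀ + Σ_{k<s₀} (α k + β k·H⁺_k) + Σ_{k<s₀} (α k + β k·H⁻_k) − 2·22/(21 s₀³ η₁⁴)`. [this file] -/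
theorem siteEnergy_affine_lower {δ η₁ η₂ : ℝ} {a b n : E3} {w : ℤ → E3} {s₀ : ℕ} {α β : ℕ → ℝ} (hδ : 9 / 10 ≤ δ)
    (hab : LinearIndependent ℝ ![a, b]) (ha : ‖a‖ ≤ 17 / 16) (hb : ‖b‖ ≤ 17 / 16) (hs : IsSep δ (Layered a b w)) (hn : IsUnitNormal a b n)
    (h38 : 3 / 8 ≤ η₁) (hband : ∀ m : ℤ, η₁ ≤ ⟪incr w m, n⟫ ∧ ⟪incr w m, n⟫ ≤ η₂) (hs₀ : 4 ≤ s₀)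
    (hmin : ∀ s : ℕ, s < s₀ → ∀ P : ℝ, ((s : ℝ) + 1) * η₁ ≤ P → P ≤ ((s : ℝ) + 1) * η₂ → ∀ u : E3, ⟪u, n⟫ = 0 →
      α s + β s * P ≤ layerField a b (P • n + u))
    (m₀ i₀ j₀ : ℤ) :
    layerField a b 0 + (∑ k ∈ range s₀, (α k + β k * ⟪w (m₀ + ((k : ℤ) + 1)) - w m₀, n⟫))
        + (∑ k ∈ range s₀, (α k + β k * ⟪w m₀ - w (m₀ - ((k : ℤ) + 1)), n⟫)) - 2 * (22 / (21 * (s₀ : ℝ) ^ 3 * η₁ ^ 4))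
      ≤ siteEnergy (Layered a b w) ((((i₀ : ℤ) : ℝ) • a + ((j₀ : ℤ) : ℝ) • b) + w m₀) := by
  classical
  have hδ0 : (0 : ℝ) < δ := by linarith
  have hη : 0 < η₁ := by linarith
  have hs₀' : (4 : ℝ) ≤ s₀ := by exact_mod_cast hs₀
  have hlat : ∀ i j : ℤ, ((i : ℝ) • a + (j : ℝ) • b) ≠ 0 → 9 / 10 ≤ ‖(i : ℝ) • a + (j : ℝ) • b‖ :=
    fun i j hij => hδ.trans (le_norm_latticeVec_of_isSep hs i j hij)
  have hG := gram_ge_of_cell hab ha hb hlat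
  have hpos : ∀ m : ℤ, 0 < ⟪incr w m, n⟫ := fun m => hη.trans_le (hband m).1
  -- DEC
  obtain ⟨hF, hE⟩ := siteEnergy_layered hab hn (strictMono_heights hpos) ⟨δ, hδ0, hs⟩ m₀ i₀ j₀
  rw [hE]
  set F : ℤ → ℝ := fun m => layerField a b (w m - w m₀) with hFdef
  -- recentre at `m₀` and split `ℤ = {0} ∪ (ℕ+1) ∪ −(ℕ+1)`
  set g : ℤ → ℝ := fun t => F (m₀ + t) with hg
  have hgS : Summable g := hF.comp_injective (add_right_injective m₀)
  have hsum : ∑' m, F m = ∑' t, g t := by rw [← (Equiv.addLeft m₀).tsum_eq]; rfl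
  set u : ℕ → ℝ := fun k => g ((k : ℤ) + 1) with hu
  set d : ℕ → ℝ := fun k => g (-((k : ℤ) + 1)) with hd
  have huS : Summable u := hgS.comp_injective (i := fun k : ℕ => (k : ℤ) + 1) fun a b h => by simpa using h
  have hdS : Summable d := hgS.comp_injective (i := fun k : ℕ => -((k : ℤ) + 1)) fun a b h => by simpa using h
  have hg0S : Summable (fun k : ℕ => g k) := hgS.comp_injective Nat.cast_injective
  have hsplitZ : ∑' t, g t = ∑' k : ℕ, g k + ∑' k : ℕ, d k := tsum_of_nat_of_neg_add_one hg0S hdS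
  have hsplitN : ∑' k : ℕ, g k = g 0 + ∑' k : ℕ, u k := by
    rw [hg0S.tsum_eq_zero_add]
    push_cast
    rfl
  have hU := huS.sum_add_tsum_nat_add s₀
  have hD := hdS.sum_add_tsum_nat_add s₀
  -- the centre term is the in-plane self field
  have hg0 : g 0 = layerField a b 0 := by simp [hg, hFdef]
  -- near terms
  have hu_near : ∀ k ∈ range s₀, α k + β k * ⟪w (m₀ + ((k : ℤ) + 1)) - w m₀, n⟫ ≤ u k := by
    intro k hk
    obtain ⟨h1, h2⟩ := span_height_bounds_up hband m₀ k
    exact layerField_ge_affine hn hmin (mem_range.1 hk) h1 h2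
  have hd_near : ∀ k ∈ range s₀, α k + β k * ⟪w m₀ - w (m₀ - ((k : ℤ) + 1)), n⟫ ≤ d k := by
    intro k hk
    obtain ⟨h1, h2⟩ := span_height_bounds_down hband m₀ k
    have := layerField_ge_affine hn hmin (mem_range.1 hk) h1 h2
    simp only [hd, hg, hFdef]
    rwa [layerField_sub_comm, ← sub_eq_add_neg]
  -- far terms
  have hu_far : ∀ k : ℕ, -(22 / 7 * (η₁ ^ 4)⁻¹ * ((((k : ℝ) + s₀ + 1) ^ 4)⁻¹)) ≤ u (k + s₀) := by
    intro k
    have h1 := (span_height_bounds_up hband m₀ (k + s₀)).1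
    have := layerField_ge_far hab hn ha hb hG h38 hs₀ (v := w (m₀ + (((k + s₀ : ℕ) : ℤ) + 1)) - w m₀) (by push_cast at h1 ⊢; exact h1)
    simpa [hu, hg, hFdef] using this
  have hd_far : ∀ k : ℕ, -(22 / 7 * (η₁ ^ 4)⁻¹ * ((((k : ℝ) + s₀ + 1) ^ 4)⁻¹)) ≤ d (k + s₀) := by
    intro k
    have h1 := (span_height_bounds_down hband m₀ (k + s₀)).1
    have := layerField_ge_far hab hn ha hb hG h38 hs₀ (v := w m₀ - w (m₀ - (((k + s₀ : ℕ) : ℤ) + 1))) (by push_cast at h1 ⊢; exact h1)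
    simp only [hd, hg, hFdef]
    rw [layerField_sub_comm, ← sub_eq_add_neg]
    push_cast at this ⊢
    exact this
  -- the far sums
  obtain ⟨h4S, h4le⟩ := tsum_inv_pow_four_le (show (1 : ℝ) ≤ (s₀ : ℝ) by linarith)
  have hcS : Summable fun k : ℕ => -(22 / 7 * (η₁ ^ 4)⁻¹ * ((((k : ℝ) + s₀ + 1) ^ 4)⁻¹)) := (h4S.mul_left _).neg
  have hcsum : ∑' k : ℕ, -(22 / 7 * (η₁ ^ 4)⁻¹ * ((((k : ℝ) + s₀ + 1) ^ 4)⁻¹)) =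
      -(22 / 7 * (η₁ ^ 4)⁻¹ * ∑' k : ℕ, (((k : ℝ) + s₀ + 1) ^ 4)⁻¹) := by rw [tsum_neg, tsum_mul_left]
  have hTu : -(22 / (21 * (s₀ : ℝ) ^ 3 * η₁ ^ 4)) ≤ ∑' k, u (k + s₀) := by
    have h := Summable.tsum_le_tsum hu_far hcS ((summable_nat_add_iff s₀).2 huS)
    rw [hcsum] at h
    refine le_trans ?_ h
    have hpos4 : 0 < (η₁ ^ 4)⁻¹ := by positivity
    have e1 : 22 / (21 * (s₀ : ℝ) ^ 3 * η₁ ^ 4) = 22 / 7 * (η₁ ^ 4)⁻¹ * (3 * (s₀ : ℝ) ^ 3)⁻¹ := by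
      field_simp
      ring
    rw [e1]
    nlinarith [mul_le_mul_of_nonneg_left h4le hpos4.le]
  have hTd : -(22 / (21 * (s₀ : ℝ) ^ 3 * η₁ ^ 4)) ≤ ∑' k, d (k + s₀) := by
    have h := Summable.tsum_le_tsum hd_far hcS ((summable_nat_add_iff s₀).2 hdS)
    rw [hcsum] at h
    refine le_trans ?_ h
    have hpos4 : 0 < (η₁ ^ 4)⁻¹ := by positivity
    have e1 : 22 / (21 * (s₀ : ℝ) ^ 3 * η₁ ^ 4) = 22 / 7 * (η₁ ^ 4)⁻¹ * (3 * (s₀ : ℝ) ^ 3)⁻¹ := by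
      field_simp
      ring
    rw [e1]
    nlinarith [mul_le_mul_of_nonneg_left h4le hpos4.le]
  -- assemble
  rw [hsum, hsplitZ, hsplitN, ← hU, ← hD, hg0]
  linarith [sum_le_sum hu_near, sum_le_sum hd_near]

/-- **the per-site form of the mean floor** (halved, spans paired): `φ₀/2 + Σ_{k<s₀} (α k + β k·(H⁺_k + H⁻_k)/2) − 22/(21 s₀³ η₁⁴) ≤ siteEnergy/2`. [this file] -/
theorem siteEnergy_half_affine_lower {δ η₁ η₂ : ℝ} {a b n : E3} {w : ℤ → E3} {s₀ : ℕ} {α β : ℕ → ℝ} (hδ : 9 / 10 ≤ δ)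
    (hab : LinearIndependent ℝ ![a, b]) (ha : ‖a‖ ≤ 17 / 16) (hb : ‖b‖ ≤ 17 / 16) (hs : IsSep δ (Layered a b w)) (hn : IsUnitNormal a b n)
    (h38 : 3 / 8 ≤ η₁) (hband : ∀ m : ℤ, η₁ ≤ ⟪incr w m, n⟫ ∧ ⟪incr w m, n⟫ ≤ η₂) (hs₀ : 4 ≤ s₀)
    (hmin : ∀ s : ℕ, s < s₀ → ∀ P : ℝ, ((s : ℝ) + 1) * η₁ ≤ P → P ≤ ((s : ℝ) + 1) * η₂ → ∀ u : E3, ⟪u, n⟫ = 0 →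
      α s + β s * P ≤ layerField a b (P • n + u))
    (m₀ i₀ j₀ : ℤ) :
    layerField a b 0 / 2 + (∑ k ∈ range s₀, (α k + β k * ((⟪w (m₀ + ((k : ℤ) + 1)) - w m₀, n⟫ + ⟪w m₀ - w (m₀ - ((k : ℤ) + 1)), n⟫) / 2)))
        - 22 / (21 * (s₀ : ℝ) ^ 3 * η₁ ^ 4)
      ≤ siteEnergy (Layered a b w) ((((i₀ : ℤ) : ℝ) • a + ((j₀ : ℤ) : ℝ) • b) + w m₀) / 2 := by
  have h := siteEnergy_affine_lower hδ hab ha hb hs hn h38 hband hs₀ hmin m₀ i₀ j₀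
  have e : ∑ k ∈ range s₀, (α k + β k * ((⟪w (m₀ + ((k : ℤ) + 1)) - w m₀, n⟫ + ⟪w m₀ - w (m₀ - ((k : ℤ) + 1)), n⟫) / 2)) =
      ((∑ k ∈ range s₀, (α k + β k * ⟪w (m₀ + ((k : ℤ) + 1)) - w m₀, n⟫))
        + ∑ k ∈ range s₀, (α k + β k * ⟪w m₀ - w (m₀ - ((k : ℤ) + 1)), n⟫)) / 2 := by
    rw [← sum_add_distrib, sum_div]
    refine sum_congr rfl fun k _ => ?_
    ring
  rw [e]
  linarith

end Summit.AtomisticToContinuum.Crystallization.Theorems.OverbindingBudgetEnergySiteAffineBound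

end
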